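import Literature.Topology.FourManifolds.GluckTwist
import HarnessLib

/-!
# A Gluck twist is compact: discharge of `Literature.Topology.FourManifolds.IsGluckTwist.compactSpace` (Gluck 1962, §17)

Sibling proof file of `GluckTwist.lean` (D-0014: named facts `def X : Prop` are discharged as
`theorem X_holds : X`). It discharges

* `Literature.IsGluckTwist.compactSpace_holds : IsGluckTwist.compactSpace` — every manifold `X` which is
  a Gluck twist of `S⁴` along a 2-knot `K` (`Literature.IsGluckTwist IX X K`) is compact.

This is one of the leaves of the decomposition of `Literature.Topology.FourManifolds.nonempty_homeomorph_sphere_of_isGluckTwist`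
(`Σ_K ≃ₜ S⁴`, Gluck 1962 §17 + Freedman 1982 Thm. 1.6) recorded in
`GluckTwistHomotopySphere.lean`: a homotopy 4-sphere is in particular a *closed* manifold.

## The printed argument and its formalisation

Gluck (Trans. AMS 104 (1962), §17) forms `Σ_K = (S⁴ ∖ νK) ∪_τ (S² × D²)`, visibly a finite union
of compact pieces. With the open relational model of `GluckTwist.lean` (`X` covered by open smooth
embeddings `jA : S⁴ ∖ K(S²) → X`, `jB : S² × ℝ² → X` identifying `ν (gluckMap (x, w))` with `(x, w)`
for `w ≠ 0`) the same two pieces are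

* `jB '' (S² × B̄₁)` (image of a compact set), and
* `jA '' C` with `C = (S⁴ ∖ K(S²)) ∖ ν (S² × B₁)`; `C` is compact because `ν (S² × B₁)` is an
  **open** subset of `S⁴` containing `K(S²) = ν (S² × {0})`, so that `C` is closed in `S⁴`.

They cover `X`: a point `jB (x, w)` with `‖w‖ > 1` equals `jA (ν (gluckMap (x, w)))`, and a point
`jA a` with `a = ν (y, w)`, `‖w‖ < 1` (necessarily `w ≠ 0` as `a ∉ K(S²)`) equals `jB (x', w)` where
`gluckMap (x', w) = (y, w)` (`bijOn_gluckMap`).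

The one non-formal input is the openness of `ν (S² × B₁)`, i.e. *invariance of domain* for the
smooth embedding `ν : S² × ℝ² → S⁴` between 4-manifolds. We prove it from Mathlib's definition of
immersions (`Manifold.IsImmersionAt`: in suitable charts `f` reads `u ↦ equiv (u, 0)` for a
continuous linear equivalence `equiv : E × F ≃L E'`): when `finrank E = finrank E'` the injective
linear map `u ↦ equiv (u, 0)` is surjective, hence an open map
(`LinearMap.isOpenMap_of_finiteDimensional`), and chasing neighbourhoods through the extended
charts shows that `f` maps neighbourhoods of `x` onto neighbourhoods of `f x`
(`Literature.Topology.FourManifolds.Manifold.IsImmersionAt.image_mem_nhds_of_finrank_eq`), so an immersion between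
boundaryless manifolds of the same finite dimension is an open map
(`Literature.Topology.FourManifolds.Manifold.IsImmersion.isOpenMap_of_finrank_eq`; the textbook route, e.g. Lee, *Introduction
to Smooth Manifolds*, 2nd ed. (2013), Ch. 4, goes through the inverse function theorem; none is
needed here because Mathlib's immersions are already in local normal form).

## References

* H. Gluck, *The embedding of two-spheres in the four-sphere*, Trans. Amer. Math. Soc. 104 (1962)
  308–333, §17 [GluckTAMS1962].
* R. C. Kirby, *The Topology of 4-Manifolds*, Lecture Notes in Math. 1374 (1989), Ch. I §6, p. 16
  [Kirby1989].

## Design notes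

* The general lemmas live in namespace `Literature.Manifold…` (not in Mathlib's `Manifold` namespace) to
  avoid shadowing future Mathlib declarations; they are stated for an arbitrary complete
  nontrivially normed field and finite-dimensional model spaces.
* `IsGluckTwist.compactSpace` quantifies over an arbitrary model `IX` for `X`; the proof never uses
  the charted structure of `X`, only that `jA`, `jB` are continuous with the gluing relation, so
  the discharge is equally general.
* No declaration in this file uses `sorry`.
-/

open scoped Manifold ContDiff Topology
open Function Set Filter

noncomputable section

namespace Literature.Topology.FourManifolds

/-! ## Immersions between manifolds of the same finite dimension are open maps -/

section Immersion

variable {𝕜 : Type*} [NontriviallyNormedField 𝕜] [CompleteSpace 𝕜]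
  {E : Type*} [NormedAddCommGroup E] [NormedSpace 𝕜 E] [FiniteDimensional 𝕜 E]
  {E' : Type*} [NormedAddCommGroup E'] [NormedSpace 𝕜 E'] [FiniteDimensional 𝕜 E']
  {H : Type*} [TopologicalSpace H] {G : Type*} [TopologicalSpace G]
  {I : ModelWithCorners 𝕜 E H} {J : ModelWithCorners 𝕜 E' G} [I.Boundaryless]
  {M : Type*} [TopologicalSpace M] [ChartedSpace H M]
  {N : Type*} [TopologicalSpace N] [ChartedSpace G N] {n : ℕ∞ω} {f : M → N} {x : M}

/-- **Invariance of domain for immersions, local form.** If `f : M → N` is a `C^n` immersion at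
`x`, the source `M` is boundaryless and the (finite-dimensional) model vector spaces of `M` and `N`
have the same dimension, then `f` maps neighbourhoods of `x` to neighbourhoods of `f x`. In the
charts provided by `Manifold.IsImmersionAt`, `f` reads `u ↦ equiv (u, 0)`, an injective, hence
surjective, hence open linear map `E → E'` (Lee, *Introduction to Smooth Manifolds*, 2nd ed.
(2013), Ch. 4: an immersion between manifolds of the same dimension is a local diffeomorphism).
[folklore] -/
theorem Manifold.IsImmersionAt.image_mem_nhds_of_finrank_eq
    (hf : Manifold.IsImmersionAt I J n f x) (hE : Module.finrank 𝕜 E = Module.finrank 𝕜 E')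
    {s : Set M} (hs : s ∈ 𝓝 x) : f '' s ∈ 𝓝 (f x) := by
  -- the linear model `u ↦ hf.equiv (u, 0)` of `f` is a surjective linear map, hence open
  let l : E →ₗ[𝕜] E' :=
    hf.equiv.toLinearEquiv.toLinearMap ∘ₗ LinearMap.inl 𝕜 E hf.complement
  have hl_apply : ∀ u, l u = hf.equiv (u, 0) := fun u ↦ rfl
  have hl_inj : Injective l := hf.equiv.injective.comp (Prod.mk_left_injective 0)
  have hl_open : IsOpenMap l := l.isOpenMap_of_finiteDimensional
    ((LinearMap.injective_iff_surjective_of_finrank_eq_finrank hE).1 hl_inj)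
  -- the charts in which `f` is in normal form
  set φ := hf.domChart
  set ψ := hf.codChart
  have hxφ : x ∈ φ.source := hf.mem_domChart_source
  have hfxψ : f x ∈ ψ.source := hf.mem_codChart_source
  have hw : ∀ a ∈ φ.source, ψ.extend J (f a) = l (φ.extend I a) := by
    intro a ha
    have h := hf.writtenInCharts ((φ.extend I).map_source (by rwa [φ.extend_source]))
    simp only [comp_apply] at h
    rw [φ.extend_left_inv ha] at h
    rw [h, hl_apply]
  -- push the neighbourhood `s ∩ φ.source` through the charts
  have h1 : (φ.extend I) '' (s ∩ φ.source) ∈ 𝓝 (φ.extend I x) :=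
    φ.extend_image_nhds_mem_nhds_of_boundaryless hxφ
      (inter_mem hs (φ.open_source.mem_nhds hxφ))
  have h2 : l '' ((φ.extend I) '' (s ∩ φ.source)) ∈ 𝓝 (ψ.extend J (f x)) := by
    rw [hw x hxφ]
    exact hl_open.image_mem_nhds h1
  have h3 : (ψ.extend J) ⁻¹' (l '' ((φ.extend I) '' (s ∩ φ.source))) ∈ 𝓝 (f x) :=
    (ψ.continuousAt_extend hfxψ).preimage_mem_nhds h2
  filter_upwards [h3, ψ.open_source.mem_nhds hfxψ] with y hy hyψ
  obtain ⟨_, ⟨a, ⟨has, haφ⟩, rfl⟩, hya⟩ := hy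
  refine ⟨a, has, ?_⟩
  have hfa : f a ∈ ψ.source := hf.source_subset_preimage_source haφ
  apply (ψ.extend J).injOn (by rwa [ψ.extend_source]) (by rwa [ψ.extend_source])
  rw [hw a haφ]
  exact hya

/-- **Invariance of domain for immersions.** A `C^n` immersion `f : M → N` from a boundaryless
manifold, the finite-dimensional model vector spaces of `M` and `N` having the same dimension, is
an open map (Lee, *Introduction to Smooth Manifolds*, 2nd ed. (2013), Ch. 4: such an immersion is
a local diffeomorphism). [folklore] -/
theorem Manifold.IsImmersion.isOpenMap_of_finrank_eq (hf : Manifold.IsImmersion I J n f)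
    (hE : Module.finrank 𝕜 E = Module.finrank 𝕜 E') : IsOpenMap f :=
  isOpenMap_iff_nhds_le.2 fun x ↦
    Filter.le_map fun _ hs ↦
      Manifold.IsImmersionAt.image_mem_nhds_of_finrank_eq (hf.isImmersionAt x) hE hs

/-- A smooth embedding from a boundaryless manifold to a manifold of the same finite dimension is
an open map (an open embedding); in particular its range is open. [folklore] -/
theorem Manifold.IsSmoothEmbedding.isOpenMap_of_finrank_eq
    (hf : Manifold.IsSmoothEmbedding I J n f)
    (hE : Module.finrank 𝕜 E = Module.finrank 𝕜 E') : IsOpenMap f :=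
  Manifold.IsImmersion.isOpenMap_of_finrank_eq hf.isImmersion hE

end Immersion

/-- Local notation: `𝔼 n` is the model Euclidean space `EuclideanSpace ℝ (Fin n)`. -/
local notation "𝔼 " n:arg => EuclideanSpace ℝ (Fin n)

/-- Local notation: `𝕊 n` is the unit sphere in `EuclideanSpace ℝ (Fin (n + 1))`. -/
local notation "𝕊 " n:arg => (Metric.sphere (0 : EuclideanSpace ℝ (Fin (n + 1))) 1)

/-! ## Tubular neighbourhoods of 2-knots are open -/

namespace TwoKnot.TubularNbhd

variable {K : 𝕊 2 → 𝕊 4} (ν : TwoKnot.TubularNbhd K)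

/-- A tubular neighbourhood map `ν : 𝕊 2 × ℝ² → 𝕊 4` of a 2-knot is an open map (invariance of
domain for the smooth embedding `ν` between 4-manifolds:
`Manifold.IsSmoothEmbedding.isOpenMap_of_finrank_eq`, `2 + 2 = 4`). [folklore] -/
protected theorem isOpenMap : IsOpenMap ν.toFun :=
  Manifold.IsSmoothEmbedding.isOpenMap_of_finrank_eq ν.isSmoothEmbedding (by simp)

/-- The image of an open set under a tubular neighbourhood map is open. [folklore] -/
theorem isOpen_image {s : Set ((𝕊 2) × 𝔼 2)} (hs : IsOpen s) : IsOpen (ν.toFun '' s) :=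
  ν.isOpenMap s hs

/-- The range of a tubular neighbourhood map is an open neighbourhood of the knot. [folklore] -/
theorem isOpen_range : IsOpen (range ν.toFun) :=
  ν.isOpenMap.isOpen_range

end TwoKnot.TubularNbhd

/-! ## Compactness of Gluck twists -/

section Compact

variable {EX HX : Type*} [NormedAddCommGroup EX] [NormedSpace ℝ EX] [TopologicalSpace HX]
  {IX : ModelWithCorners ℝ EX HX} {X : Type*} [TopologicalSpace X] [ChartedSpace HX X]
  {K : TwoKnot}

/-- **A Gluck twist is compact** (Gluck, Trans. AMS 104 (1962), §17): if `X` is a Gluck twist of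
`S⁴` along `K`, with gluing embeddings `jA : S⁴ ∖ K(S²) → X`, `jB : S² × ℝ² → X` and tubular
neighbourhood `ν`, then `X = jA '' C ∪ jB '' (S² × B̄₁)` with `C = (S⁴ ∖ K(S²)) ∖ ν (S² × B₁)`
closed in `S⁴` (as `ν (S² × B₁)` is open, `TwoKnot.TubularNbhd.isOpen_image`, and contains
`K(S²)`), a union of two compact sets. Discharges `IsGluckTwist.compactSpace`.
[cite: GluckTAMS1962, §17] -/
theorem IsGluckTwist.compactSpace_holds :
    IsGluckTwist.compactSpace (IX := IX) (X := X) (K := K) := by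
  intro h
  obtain ⟨ν, jA, jB, hA, -, hB, -, hU, hR⟩ := h
  -- the open tube of radius `1` and the closed piece of the complement outside it
  set U : Set (𝕊 4) := ν.toFun '' (univ ×ˢ Metric.ball (0 : 𝔼 2) 1) with hUdef
  have hUo : IsOpen U := ν.isOpen_image (isOpen_univ.prod Metric.isOpen_ball)
  set C : Set K.complement := Subtype.val ⁻¹' Uᶜ with hCdef
  have hC : IsCompact C := by
    rw [Subtype.isCompact_iff]
    have hCU : Subtype.val '' C = Uᶜ := by
      apply image_preimage_eq_of_subset
      intro p hp
      refine ⟨⟨p, ?_⟩, rfl⟩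
      rw [SphereEmbedding.mem_complement_iff]
      rintro ⟨y, rfl⟩
      exact hp ⟨(y, 0), ⟨mem_univ _, Metric.mem_ball_self one_pos⟩, ν.apply_zero y⟩
    rw [hCU]
    exact hUo.isClosed_compl.isCompact
  have hD : IsCompact ((univ : Set (𝕊 2)) ×ˢ Metric.closedBall (0 : 𝔼 2) 1) :=
    isCompact_univ.prod (isCompact_closedBall 0 1)
  -- every point of `jA (S⁴ ∖ K)` lies in one of the two pieces
  have key : ∀ a : K.complement,
      jA a ∈ jA '' C ∪ jB '' ((univ : Set (𝕊 2)) ×ˢ Metric.closedBall (0 : 𝔼 2) 1) := by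
    intro a
    by_cases ha : a ∈ C
    · exact Or.inl ⟨a, ha, rfl⟩
    · have haU : (a : 𝕊 4) ∈ U := by
        by_contra haU
        exact ha haU
      obtain ⟨⟨y, w⟩, ⟨-, hw⟩, hya⟩ := haU
      have hw0 : w ≠ 0 := by
        rintro rfl
        exact a.2 ⟨y, (ν.apply_zero y).symm.trans hya⟩
      obtain ⟨⟨x', w'⟩, -, hxy⟩ :=
        bijOn_gluckMap.surjOn (show ((y, w) : (𝕊 2) × 𝔼 2) ∈ {p | p.2 ≠ 0} from hw0)
      have hww : w' = w := by simpa using congrArg Prod.snd hxy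
      subst hww
      refine Or.inr ⟨(x', w'), ⟨mem_univ _, Metric.ball_subset_closedBall hw⟩, ?_⟩
      rw [eq_comm, hR]
      exact ⟨hw0, by rw [hxy, hya]⟩
  -- the two pieces cover `X`
  have hcov : jA '' C ∪ jB '' ((univ : Set (𝕊 2)) ×ˢ Metric.closedBall (0 : 𝔼 2) 1) = univ := by
    refine eq_univ_of_forall fun p ↦ ?_
    have hp : p ∈ range jA ∪ range jB := by rw [hU]; exact mem_univ p
    obtain ⟨a, rfl⟩ | ⟨⟨x, w⟩, rfl⟩ := hp
    · exact key a
    · by_cases hw : ‖w‖ ≤ 1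
      · exact Or.inr ⟨(x, w), ⟨mem_univ _, mem_closedBall_zero_iff.2 hw⟩, rfl⟩
      · have hw0 : w ≠ 0 := by
          rintro rfl
          exact hw (by simp)
        have hm : ν.toFun (gluckMap (x, w)) ∈ K.complement := by
          rw [gluckMap_apply_of_ne_zero x hw0]
          exact ν.apply_mem_compl_range _ hw0
        have hj : jA ⟨ν.toFun (gluckMap (x, w)), hm⟩ = jB (x, w) :=
          (hR _ _).2 (gluckRel_mk_gluckMap ν x hw0 hm)
        rw [← hj]
        exact key _
  refine ⟨?_⟩
  rw [← hcov]
  exact (hC.image hA.isEmbedding.continuous).union (hD.image hB.isEmbedding.continuous)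

end Compact

end Literature.Topology.FourManifolds

end
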